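import Summits.KontsevichZagierPeriods.KontsevichZagierPeriods.Theorems.ComplexOrientationsOrientationKernelRouteExactness
import Summits.KontsevichZagierPeriods.KontsevichZagierPeriods.Theorems.ComplexOrientationsOrientationKernelReductionNecessity
import Summits.KontsevichZagierPeriods.KontsevichZagierPeriods.Theorems.SymplecticScissorsPlanarTransport
import Summits.KontsevichZagierPeriods.KontsevichZagierPeriods.Theorems.AbelContractionRealArcKernelSplit

/-!
# `OrientationKernel` (stmt-KontsevichZagierPeriods-11367) — equivalence audit (crux-strategist q1, 2026-08-17)

The exact trust base of the detector's witness
`kontsevichZagierPeriods_iff_orientationKernel_and_ovalSector : KontsevichZagierPeriods ↔ OrientationKernel ∧ OvalSector`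
(Theorems/ComplexOrientationsOrientationKernelRouteExactness.lean:167, p150030):

1. the equivalence `OrientationKernel ↔ S` is CONDITIONAL on the open sibling `OvalSector` (stmt-11369) — it is
   not "unconditional with no siblings" (the `summit_equivalent` record mis-reads the conjunct as absent);
2. unconditionally both conjuncts are consequences of `S`;
3. the sibling is settled MODULO ONE PUBLISHED THEOREM: the cite-only named fact
   `HuberWustholzCurvePeriods` (Huber–Wüstholz 2022, Thm 13.3 (2)) gives `PlanarAreas` (landed transfer
   `planarAreas_of_huberWustholzCurvePeriods`, SymplecticScissors) and `PlanarAreas → OvalSector` (landed);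
4. hence modulo that fact the crux IS the summit (axioms printed below: the fact enters only as a hypothesis);
5. modulo `PlanarAreas` the three residual targets `OrientationKernel` (this route), `RealArcKernel`
   (AbelContraction, stmt-12472) and `ReductionToDimensionOne` (stmt-14403) are ONE statement;
6. the redirect one OPEN layer up the input-dimension filtration, shared with `RealArcKernel`:
   `KZDimTwo (stmt-4280) → ReductionToDimensionTwo (stmt-18030) → OrientationKernel` (assembly, pure logic) and
   `OrientationKernel → ReductionToDimensionTwo` (necessity); the two pieces also give the route's whole cone
   `OrientationKernel ∧ OvalSector`.
Scratch only — nothing here is a route item; namespace private to this audit. Companion: EQUIVALENCE-AUDIT.md.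
-/

open Literature.NumberTheory.Transcendental
open Summit.KontsevichZagierPeriods.KontsevichZagierPeriods.Theses.ComplexOrientations
  (OrientationKernel OvalSector TypeOneIdentities)
open Summit.KontsevichZagierPeriods.KontsevichZagierPeriods.Theses.AbelContraction
  (PlanarAreas ReductionToDimensionOne KZDimTwo ReductionToDimensionTwo RealArcKernel)
open Summit.KontsevichZagierPeriods.ComplexOrientations.OrientationKernel

namespace Summit.KontsevichZagierPeriods.ComplexOrientations.OrientationKernelEquivalenceAudit

-- (0) the two route copies of the shared item stmt-4990 are the same proposition
example : Summit.KontsevichZagierPeriods.KontsevichZagierPeriods.Theses.SymplecticScissors.PlanarAreas ↔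
    Summit.KontsevichZagierPeriods.KontsevichZagierPeriods.Theses.AbelContraction.PlanarAreas := Iff.rfl

-- (1) the witness is CONDITIONAL on the open sibling: OvalSector → (OrientationKernel ↔ S)
theorem orientationKernel_iff_summit_of_ovalSector (hOS : OvalSector) :
    OrientationKernel ↔ KontsevichZagierPeriods :=
  ⟨fun hK => kontsevichZagierPeriods_iff_orientationKernel_and_ovalSector.2 ⟨hK, hOS⟩,
    fun hS => (kontsevichZagierPeriods_iff_orientationKernel_and_ovalSector.1 hS).1⟩

-- (2) unconditionally: both conjuncts are consequences of the summit
theorem orientationKernel_of_summit (hS : KontsevichZagierPeriods) : OrientationKernel :=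
  (kontsevichZagierPeriods_iff_orientationKernel_and_ovalSector.1 hS).1

theorem ovalSector_of_summit (hS : KontsevichZagierPeriods) : OvalSector :=
  (kontsevichZagierPeriods_iff_orientationKernel_and_ovalSector.1 hS).2

-- (3) the sibling modulo the cite-only fact: HW → PlanarAreas → OvalSector (and TypeOneIdentities)
theorem planarAreas_of_HW (hHW : HuberWustholzCurvePeriods) : PlanarAreas :=
  Summit.KontsevichZagierPeriods.SymplecticScissors.PlanarTransport.planarAreas_of_huberWustholzCurvePeriods hHW

theorem ovalSector_of_HW (hHW : HuberWustholzCurvePeriods) : OvalSector :=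
  ovalSector_of_planarAreas (planarAreas_of_HW hHW)

theorem typeOneIdentities_of_HW (hHW : HuberWustholzCurvePeriods) : TypeOneIdentities :=
  typeOneIdentities_of_planarAreas (planarAreas_of_HW hHW)

-- (4) hence modulo HW 2022 Thm 13.3(2) the crux IS the summit
theorem orientationKernel_iff_summit_of_HW (hHW : HuberWustholzCurvePeriods) :
    OrientationKernel ↔ KontsevichZagierPeriods :=
  orientationKernel_iff_summit_of_ovalSector (ovalSector_of_HW hHW)

-- (5) modulo PlanarAreas the residual targets of ComplexOrientations and AbelContraction coincide (with stmt-14403)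
theorem orientationKernel_iff_realArcKernel_of_planarAreas (hP : PlanarAreas) :
    OrientationKernel ↔ RealArcKernel :=
  (orientationKernel_iff_reductionToDimensionOne_of_planarAreas hP).trans
    (Summit.KontsevichZagierPeriods.AbelContraction.RealArcKernelStrength.realArcKernel_iff_reductionToDimensionOne
      hP).symm

theorem orientationKernel_iff_realArcKernel_of_HW (hHW : HuberWustholzCurvePeriods) :
    OrientationKernel ↔ RealArcKernel :=
  orientationKernel_iff_realArcKernel_of_planarAreas (planarAreas_of_HW hHW)

-- (6) the redirect one OPEN layer up (shared with RealArcKernel): assembly, necessity, and the whole route cone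
theorem orientationKernel_of_subs (h₂ : KZDimTwo) (hRed : ReductionToDimensionTwo) : OrientationKernel :=
  fun R hR _ _ _ x hx => hRed R hR (fun _ _ hn hm r r' hr hr' hv => hR (h₂ hn hm r r' hr hr' hv)) x hx

theorem reductionToDimensionTwo_of_orientationKernel (hK : OrientationKernel) : ReductionToDimensionTwo :=
  Summit.KontsevichZagierPeriods.AbelContraction.RealArcKernelSplit.reductionToDimensionTwo_of_reductionToDimensionOne
    (reductionToDimensionOne_of_orientationKernel hK)

theorem orientationKernel_and_ovalSector_of_subs (h₂ : KZDimTwo) (hRed : ReductionToDimensionTwo) :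
    OrientationKernel ∧ OvalSector :=
  ⟨orientationKernel_of_subs h₂ hRed,
    ovalSector_of_planarAreas
      (Summit.KontsevichZagierPeriods.AbelContraction.RealArcKernelSplit.planarAreas_of_kzDimTwo h₂)⟩

-- neither piece is touched by HW: KZDimTwo contains PlanarAreas (the HW layer) strictly, as its integrand-1 part
example (h₂ : KZDimTwo) : PlanarAreas :=
  Summit.KontsevichZagierPeriods.AbelContraction.RealArcKernelSplit.planarAreas_of_kzDimTwo h₂

end Summit.KontsevichZagierPeriods.ComplexOrientations.OrientationKernelEquivalenceAudit

#print axioms Summit.KontsevichZagierPeriods.ComplexOrientations.OrientationKernel.kontsevichZagierPeriods_iff_orientationKernel_and_ovalSector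
#print axioms Summit.KontsevichZagierPeriods.SymplecticScissors.PlanarTransport.planarAreas_of_huberWustholzCurvePeriods
#print axioms Summit.KontsevichZagierPeriods.ComplexOrientations.OrientationKernel.ovalSector_of_planarAreas
#print axioms Summit.KontsevichZagierPeriods.ComplexOrientations.OrientationKernelEquivalenceAudit.orientationKernel_iff_summit_of_HW
#print axioms Summit.KontsevichZagierPeriods.ComplexOrientations.OrientationKernelEquivalenceAudit.orientationKernel_iff_realArcKernel_of_HW
#print axioms Summit.KontsevichZagierPeriods.ComplexOrientations.OrientationKernelEquivalenceAudit.orientationKernel_of_subs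
#print axioms Summit.KontsevichZagierPeriods.ComplexOrientations.OrientationKernelEquivalenceAudit.reductionToDimensionTwo_of_orientationKernel
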